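import Summits.AtomisticToContinuum.FouriersLaw.Theses.PhononLorentzGas
import Summits.AtomisticToContinuum.FouriersLaw.Theorems.OddSectorIrreversibilityBoundedResponseConvergesStubPositiveConductance

/-!
# Birth skeleton (BC3) for crux `PhononLorentzGas.DilutionComparison`
(item `stmt-AtomisticToContinuum-12793`, route `route-AtomisticToContinuum-PhononLorentzGas`, crux rank 3;
sub-problem `FouriersLaw`; registrar `planner-skel-stmt-AtomisticToContinuum-12793-0`, 2026-08-17)

Crux (FIXED, concluded BY NAME below): for all `ω₂ lam β γ > 0` and `T > 0` there is `ℓ₁` such that for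
every period `ℓ ≥ ℓ₁` there is `N₀` with: for `N ≥ N₀`, every finite-`N` response coefficient `D` of the
DENSE chain `cellChain ω₂ lam β γ (fun _ => true)` (`= (pinnedChain ω₂ lam β γ).toSiteChain`, `rfl`) at
temperature `T` and every response coefficient `D'` of the DILUTE chain
`P_ℓ = cellChain ω₂ lam β γ (cellPeriodic ℓ)` at the same `N, T` satisfy `D ≤ D'`.

## Line `birth` — SERIES AMPLIFIER × NON-BALLISTIC BLOCK (dense side) × DILUTE DELOCALISATION (dilute side)

Write `R_n(D) := (n - 1)/D` for the bath-to-bath linear-response RESISTANCE of a chain of length `n` with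
response coefficient `D > 0` (`D = lim δ⁻¹ · totalCurrent = (n-1) · conductance`), and `m = ⌊N/ℓ⌋ = N / ℓ`
for the number of complete `ℓ`-blocks of `{0, …, N-1}` (equivalently the number of cells of `P_ℓ` below `N`).

* `stub_denseJunctionLaw` (J) — SERIES LAW OF THE DENSE CHAIN ALONG `ℓ`-BLOCK DECOMPOSITIONS, up to a
  `(1-ε)` slack and an `O(1)` junction defect `r = r(T, ε)` per block:
  `⌊N/ℓ⌋ · ((1-ε) R_ℓ(d) - r) ≤ R_N(D)` for all positive coefficients `D` (length `N ≥ N₀(ℓ)`) and `d`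
  (length `ℓ ≥ ℓ₁(ε)`) of the dense chain.  The AMPLIFIER: one resistive block size forces linear growth
  of the resistance.  NECESSARY for the conjunct (it follows from `D_N → κ ∈ (0,∞)` with `r = 0`); true at
  the harmonic corner with `r ≥ sup_ℓ 1/c_ℓ` (so by itself it does NOT bound `D_N`); implied by the
  stronger, ε-free binary law `SuperadditiveJunction.SuperadditiveResistance` (stmt of a sibling route, open).
  This is where "cells thermalise inside the DENSE chain too" (the crux's why-might-fail) lives.  Size XL.
* `stub_denseNonBallistic` (NB) — THE DENSE CHAIN IS NOT A BALLISTIC CONDUCTOR: for every `K > 0` there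
  are arbitrarily long dense chains all of whose response coefficients satisfy `K · d ≤ ℓ - 1`
  (conductance `≤ 1/K` frequently).  NECESSARY for the conjunct; shared in substance with
  `SuperadditiveJunction.NonBallistic` (stmt-AtomisticToContinuum-2192); false exactly at the harmonic
  corner (`HarmonicChainBallisticFlux`), so it USES `lam, β > 0`.  Size L–XL (nothing in print gives
  `J_N → 0` for a deterministic anharmonic bulk, BLR2000 §6.3).
* `stub_diluteDelocalisation` (DX) — SUFFICIENTLY DILUTE CHAINS EVENTUALLY OUT-CONDUCT ANY CONSTANT:
  `∀ B ∃ ℓ₁ ∀ ℓ ≥ ℓ₁ ∃ N₀ ∀ N ≥ N₀`, every response coefficient `D'` of `P_ℓ` at `(N, T)` is `≥ B`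
  (`lim_ℓ liminf_N D'_N(P_ℓ) = +∞`; kinetic prediction `D'_N(P_ℓ) → ℓ/r₁(T)`, the Ohmic floor
  `R_N(P_ℓ) ≤ r₀(T) + r₁(T)·⌊N/ℓ⌋` being the expected quantitative form).  The dilute/renewal side of the
  route (the LOWER half of the rung's two-sided prediction; the rung `DiluteBoundedResponse` is the upper
  half).  Size XL.
* PROVED here (no sorry): `densePositiveResponse` — at every `N ≥ 2`, `T > 0` the dense chain HAS a
  positive response coefficient (in tree: `pinnedSteadyStateExists_proof` CEHR2018, `nessUnique_proof`,
  `FourierGreenKubo.finiteResponse_of_unique` and `…Stubs.positiveConductance_holds`, Kundu–Dhar–Narayan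
  Green–Kubo made strict); `denseEventualUpperBound_of_junction_of_nonBallistic` — (J) ∧ (NB) ⇒ the dense
  chain's response coefficients are eventually `≤ 2ℓ'` for ONE resistive block size `ℓ'` (real arithmetic:
  `⌊N/ℓ'⌋ ≤ R_N(D)`, `2ℓ'⌊N/ℓ'⌋ ≥ N - 1`); `dilutionComparison_of_denseUpper_of_delocalisation` — the
  interval cut `D ≤ B ≤ D'`; the sorry-free implication `dilutionComparison_of_stubs : (J) → (NB) → (DX) → ‹definiens of
  the crux, verbatim›`; and the registered skeleton theorem `DilutionComparison_of : DilutionComparison` (crux BY NAME,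
  no hypotheses) = that implication applied to the three stubs.

Honest reading for the lead / strategist: modulo the dilute-side statement (DX) (and the rung), the crux is
EQUIVALENT IN STRENGTH to one-sided eventual bounded response of the dense chain at each `T` (the interval
cut is forced: `D'_N(P_ℓ)` is `N`-bounded for fixed `ℓ`); this line's bet for that dense half is the
factorisation (J) × (NB), each factor a necessary consequence of the conjunct and neither alone a bound on
`D_N`.  Disproof used: none on file (`ledger crux ls stmt-AtomisticToContinuum-12793`: no workfiles,
2026-08-17); negatives index: no FouriersLaw entry bears on response coefficients of cell chains.
-/

noncomputable section

namespace Summit.AtomisticToContinuum.FouriersLaw.Cruxes.DilutionComparison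

namespace Birth

open MeasureTheory Filter Topology

/-! ## The three registered stubs -/

/-- **stub 1 — `stub_denseJunctionLaw` (series law of the dense chain along block decompositions).**
For `ω₂ lam β γ > 0`, `T > 0` and every slack `ε ∈ (0,1)` there are a junction defect `r` and `ℓ₁` such
that for every block length `ℓ ≥ ℓ₁` there is `N₀` with: for all `N ≥ N₀` and all POSITIVE response
coefficients `D` (dense chain, length `N`) and `d` (dense chain, length `ℓ`),
`⌊N/ℓ⌋ · ((1 - ε) · (ℓ - 1)/d - r) ≤ (N - 1)/D` — the resistance of the long chain is at least the number
of complete `ℓ`-blocks times the block resistance, up to the slack and an `O(1)` defect per junction.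
Necessary for the conjunct; true (vacuously in strength) at the harmonic corner; implied by
`SuperadditiveJunction.SuperadditiveResistance`. -/
theorem stub_denseJunctionLaw :
    ∀ ω₂ lam β γ : ℝ, 0 < ω₂ → 0 < lam → 0 < β → 0 < γ → ∀ T : ℝ, 0 < T → ∀ ε : ℝ, 0 < ε → ε < 1 → ∃ r : ℝ, ∃ ℓ₁ : ℕ, ∀ ℓ : ℕ, ℓ₁ ≤ ℓ → ∃ N₀ : ℕ, ∀ N : ℕ, N₀ ≤ N → ∀ D d : ℝ, (Literature.MathematicalPhysics.KineticTheory.HeatConduction.cellChain ω₂ lam β γ (fun _ => true)).IsResponseCoeff N T D → (Literature.MathematicalPhysics.KineticTheory.HeatConduction.cellChain ω₂ lam β γ (fun _ => true)).IsResponseCoeff ℓ T d → 0 < D → 0 < d → ((N / ℓ : ℕ) : ℝ) * ((1 - ε) * (((ℓ : ℝ) - 1) / d) - r) ≤ ((N : ℝ) - 1) / D := by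
  sorry

/-- **stub 2 — `stub_denseNonBallistic` (the dense anharmonic chain is not a ballistic conductor).**
For `ω₂ lam β γ > 0`, `T > 0`, every `K > 0` and every `ℓ₀` there is a length `ℓ ≥ ℓ₀` at which EVERY
response coefficient `d` of the dense chain satisfies `K · d ≤ ℓ - 1` (conductance `d/(ℓ-1) ≤ 1/K`):
`liminf_ℓ G_ℓ = 0`.  Necessary for the conjunct (`D_ℓ → κ < ∞`); in substance
`SuperadditiveJunction.NonBallistic` (stmt-AtomisticToContinuum-2192) over `SiteChain.IsResponseCoeff`;
false at `lam = β = 0`. -/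
theorem stub_denseNonBallistic :
    ∀ ω₂ lam β γ : ℝ, 0 < ω₂ → 0 < lam → 0 < β → 0 < γ → ∀ T : ℝ, 0 < T → ∀ K : ℝ, 0 < K → ∀ ℓ₀ : ℕ, ∃ ℓ : ℕ, ℓ₀ ≤ ℓ ∧ ∀ d : ℝ, (Literature.MathematicalPhysics.KineticTheory.HeatConduction.cellChain ω₂ lam β γ (fun _ => true)).IsResponseCoeff ℓ T d → K * d ≤ (ℓ : ℝ) - 1 := by
  sorry

/-- **stub 3 — `stub_diluteDelocalisation` (sufficiently dilute chains eventually out-conduct any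
constant).**  For `ω₂ lam β γ > 0`, `T > 0` and every `B` there is `ℓ₁` such that for every period
`ℓ ≥ ℓ₁` there is `N₀` with: for `N ≥ N₀`, every response coefficient `D'` of the dilute chain
`P_ℓ = cellChain ω₂ lam β γ (cellPeriodic ℓ)` at `(N, T)` satisfies `B ≤ D'`.  The dilute (renewal /
phonon-Lorentz-gas) side: `lim_ℓ liminf_N D'_N(P_ℓ) = +∞`, predicted `D'_N(P_ℓ) → ℓ/r₁(T)`. -/
theorem stub_diluteDelocalisation :
    ∀ ω₂ lam β γ : ℝ, 0 < ω₂ → 0 < lam → 0 < β → 0 < γ → ∀ T : ℝ, 0 < T → ∀ B : ℝ, ∃ ℓ₁ : ℕ, ∀ ℓ : ℕ, ℓ₁ ≤ ℓ → ∃ N₀ : ℕ, ∀ N : ℕ, N₀ ≤ N → ∀ D' : ℝ, (Literature.MathematicalPhysics.KineticTheory.HeatConduction.cellChain ω₂ lam β γ (Literature.MathematicalPhysics.KineticTheory.HeatConduction.cellPeriodic ℓ)).IsResponseCoeff N T D' → B ≤ D' := by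
  sorry

/-! ## Proved in tree: the dense chain has a positive response coefficient at every `N ≥ 2` -/

section Proved

open Literature.MathematicalPhysics.KineticTheory.HeatConduction

/-- **Positive response of the dense chain (sorry-free, from landed theorems).**  For `ω₂ lam β γ > 0`,
`T > 0` and `N ≥ 2` there is `d > 0` with `(cellChain ω₂ lam β γ (fun _ => true)).IsResponseCoeff N T d`:
the canonical steady-state family exists (`pinnedSteadyStateExists_proof`, Cuneo–Eckmann–Hairer–Rey-Bellet
2018 Thm 2.13), is unique (`nessUnique_proof`), has `δ`-limits (`FourierGreenKubo.finiteResponse_of_unique`,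
Kundu–Dhar–Narayan Green–Kubo) and these are positive for `N ≥ 2` (`Stubs.positiveConductance_holds`);
the dense cell chain is `(pinnedChain ω₂ lam β γ).toSiteChain` by `rfl`. -/
theorem densePositiveResponse {ω₂ lam β γ : ℝ} (hω : 0 < ω₂) (hl : 0 < lam) (hβ : 0 < β)
    (hγ : 0 < γ) {T : ℝ} (hT : 0 < T) {N : ℕ} (hN : 2 ≤ N) :
    ∃ d : ℝ, (cellChain ω₂ lam β γ (fun _ => true)).IsResponseCoeff N T d ∧ 0 < d := by
  classical
  have huniq : ∀ (n : ℕ) (T_L T_R : ℝ), 0 < T_L → 0 < T_R →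
      ∀ μ ν : Measure (PhaseSpace n), (pinnedChain ω₂ lam β γ).IsSteadyState n T_L T_R μ →
        (pinnedChain ω₂ lam β γ).IsSteadyState n T_L T_R ν → μ = ν :=
    Summit.AtomisticToContinuum.FouriersLaw.Theorems.nessUnique_proof ω₂ lam β γ hω hl hβ hγ
  have hex : ∀ (n : ℕ) (T_L T_R : ℝ), 0 < T_L → 0 < T_R →
      ∃ μ : Measure (PhaseSpace n), (pinnedChain ω₂ lam β γ).IsSteadyState n T_L T_R μ :=
    fun n T_L T_R hL hR =>
      Summit.AtomisticToContinuum.FouriersLaw.Theorems.pinnedSteadyStateExists_proof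
        ω₂ lam β γ hω hl hβ hγ n T_L T_R hL hR
  let μ₀ : (n : ℕ) → ℝ → ℝ → Measure (PhaseSpace n) := fun n T_L T_R =>
    if h : 0 < T_L ∧ 0 < T_R then Classical.choose (hex n T_L T_R h.1 h.2) else 0
  have hμ₀ : ∀ (n : ℕ) (T_L T_R : ℝ), 0 < T_L → 0 < T_R →
      (pinnedChain ω₂ lam β γ).IsSteadyState n T_L T_R (μ₀ n T_L T_R) := by
    intro n T_L T_R hL hR
    simp only [μ₀, dif_pos (And.intro hL hR)]
    exact Classical.choose_spec (hex n T_L T_R hL hR)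
  choose D hD using
    Summit.AtomisticToContinuum.FouriersLaw.Theorems.FourierGreenKubo.finiteResponse_of_unique
      ω₂ lam β γ hω hl hβ hγ huniq μ₀ hμ₀ T hT
  have hpos : 0 < D N :=
    Summit.AtomisticToContinuum.FouriersLaw.Cruxes.BoundedResponseConverges.TwoScaleGluingLogRigidity.Stubs.positiveConductance_holds
      ω₂ lam β γ hω hl hβ hγ huniq μ₀ hμ₀ T hT D hD N hN
  exact ⟨D N, ⟨μ₀ N, fun T_L T_R hL hR => hμ₀ N T_L T_R hL hR, hD N⟩, hpos⟩

/-! ## The dense half, named, and the two sorry-free reductions -/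

/-! The dense half of the interval cut — ONE-SIDED EVENTUAL BOUNDED RESPONSE OF THE DENSE CHAIN AT `T`
(`DenseEventualUpperBound`, written out, not a registered stub: it is DERIVED from (J) ∧ (NB)):
`∀ ω₂ lam β γ > 0, ∀ T > 0, ∃ B N₁, ∀ N ≥ N₁, ∀ D, IsResponseCoeff (dense) N T D → D ≤ B`. -/

/-- **(J) ∧ (NB) ⇒ dense eventual upper bound** (sorry-free).  Take `ε = 1/2`, its defect `r` and `ℓ₁`
from (J); by (NB) pick ONE block length `ℓ ≥ max ℓ₁ 2` whose coefficients satisfy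
`max (2(r+1)) 1 · d ≤ ℓ - 1`; by `densePositiveResponse` such a `d > 0` exists, so
`(1/2)(ℓ-1)/d - r ≥ 1` and (J) gives `⌊N/ℓ⌋ ≤ (N-1)/D` for every positive `D` at `N ≥ N₀(ℓ)`; with
`2ℓ⌊N/ℓ⌋ ≥ N - 1` (`N ≥ 2ℓ`) this is `D ≤ 2ℓ`. -/
theorem denseEventualUpperBound_of_junction_of_nonBallistic
    (hJ : ∀ ω₂ lam β γ : ℝ, 0 < ω₂ → 0 < lam → 0 < β → 0 < γ → ∀ T : ℝ, 0 < T → ∀ ε : ℝ, 0 < ε → ε < 1 → ∃ r : ℝ, ∃ ℓ₁ : ℕ, ∀ ℓ : ℕ, ℓ₁ ≤ ℓ → ∃ N₀ : ℕ, ∀ N : ℕ, N₀ ≤ N → ∀ D d : ℝ, (Literature.MathematicalPhysics.KineticTheory.HeatConduction.cellChain ω₂ lam β γ (fun _ => true)).IsResponseCoeff N T D → (Literature.MathematicalPhysics.KineticTheory.HeatConduction.cellChain ω₂ lam β γ (fun _ => true)).IsResponseCoeff ℓ T d → 0 < D → 0 < d → ((N / ℓ : ℕ) : ℝ) * ((1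 - ε) * (((ℓ : ℝ) - 1) / d) - r) ≤ ((N : ℝ) - 1) / D)
    (hNB : ∀ ω₂ lam β γ : ℝ, 0 < ω₂ → 0 < lam → 0 < β → 0 < γ → ∀ T : ℝ, 0 < T → ∀ K : ℝ, 0 < K → ∀ ℓ₀ : ℕ, ∃ ℓ : ℕ, ℓ₀ ≤ ℓ ∧ ∀ d : ℝ, (Literature.MathematicalPhysics.KineticTheory.HeatConduction.cellChain ω₂ lam β γ (fun _ => true)).IsResponseCoeff ℓ T d → K * d ≤ (ℓ : ℝ) - 1) :
    ∀ ω₂ lam β γ : ℝ, 0 < ω₂ → 0 < lam → 0 < β → 0 < γ → ∀ T : ℝ, 0 < T → ∃ B : ℝ, ∃ N₁ : ℕ,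
      ∀ N : ℕ, N₁ ≤ N → ∀ D : ℝ,
        (cellChain ω₂ lam β γ (fun _ => true)).IsResponseCoeff N T D → D ≤ B := by
  intro ω₂ lam β γ hω hl hβ hγ T hT
  obtain ⟨r, ℓ₁, hℓ₁⟩ := hJ ω₂ lam β γ hω hl hβ hγ T hT (1 / 2) (by norm_num) (by norm_num)
  -- one resistive block length `ℓ`
  obtain ⟨ℓ, hℓ, hK⟩ := hNB ω₂ lam β γ hω hl hβ hγ T hT (max (2 * (r + 1)) 1)
    (lt_of_lt_of_le one_pos (le_max_right _ _)) (max ℓ₁ 2)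
  have hℓ₁ℓ : ℓ₁ ≤ ℓ := le_trans (le_max_left _ _) hℓ
  have hℓ2 : 2 ≤ ℓ := le_trans (le_max_right _ _) hℓ
  obtain ⟨d, hd, hdpos⟩ := densePositiveResponse hω hl hβ hγ hT hℓ2
  have hKd : max (2 * (r + 1)) 1 * d ≤ (ℓ : ℝ) - 1 := hK d hd
  obtain ⟨N₀, hN₀⟩ := hℓ₁ ℓ hℓ₁ℓ
  refine ⟨2 * (ℓ : ℝ), N₀ + 2 * ℓ, fun N hN D hD => ?_⟩
  by_cases hDpos : 0 < D
  · have hJ' := hN₀ N (by omega) D d hD hd hDpos hdpos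
    -- the block resists: `(1/2)(ℓ-1)/d - r ≥ 1`
    have h1 : 2 * (r + 1) ≤ ((ℓ : ℝ) - 1) / d := by
      rw [le_div_iff₀ hdpos]
      exact le_trans (mul_le_mul_of_nonneg_right (le_max_left _ _) hdpos.le) hKd
    have hc : (1 : ℝ) ≤ (1 - 1 / 2) * (((ℓ : ℝ) - 1) / d) - r := by linarith
    have hm0 : (0 : ℝ) ≤ ((N / ℓ : ℕ) : ℝ) := Nat.cast_nonneg _
    have hm : ((N / ℓ : ℕ) : ℝ) ≤ ((N : ℝ) - 1) / D := by
      have h := mul_le_mul_of_nonneg_left hc hm0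
      rw [mul_one] at h
      exact h.trans hJ'
    have hmD : ((N / ℓ : ℕ) : ℝ) * D ≤ (N : ℝ) - 1 := by
      rwa [le_div_iff₀ hDpos] at hm
    -- `2ℓ⌊N/ℓ⌋ ≥ N - 1`
    have hnat : N < 2 * (ℓ * (N / ℓ)) := by
      have h₁ := Nat.div_add_mod N ℓ
      have h₂ := Nat.mod_lt N (show 0 < ℓ by omega)
      omega
    have hreal : (N : ℝ) - 1 ≤ 2 * (ℓ : ℝ) * ((N / ℓ : ℕ) : ℝ) := by
      have h : (N : ℝ) < ((2 * (ℓ * (N / ℓ)) : ℕ) : ℝ) := by exact_mod_cast hnat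
      push_cast at h
      linarith
    have hmpos : (0 : ℝ) < ((N / ℓ : ℕ) : ℝ) := by
      have h : 0 < N / ℓ := Nat.div_pos (by omega) (by omega)
      exact_mod_cast h
    by_contra hcon
    push Not at hcon
    have h := mul_lt_mul_of_pos_left hcon hmpos
    nlinarith [hmD, hreal, h]
  · push Not at hDpos
    exact hDpos.trans (by positivity)

/-- **The interval cut** (sorry-free): dense eventual upper bound `B(T)` and dilute delocalisation at
level `B(T)` give `D ≤ B(T) ≤ D'` — conclusion = the definiens of `PhononLorentzGas.DilutionComparison`
VERBATIM (so that `DilutionComparison_of` below is the unique theorem of this file concluding the crux BY NAME). -/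
theorem dilutionComparison_of_denseUpper_of_delocalisation
    (hB : ∀ ω₂ lam β γ : ℝ, 0 < ω₂ → 0 < lam → 0 < β → 0 < γ → ∀ T : ℝ, 0 < T → ∃ B : ℝ, ∃ N₁ : ℕ,
      ∀ N : ℕ, N₁ ≤ N → ∀ D : ℝ,
        (cellChain ω₂ lam β γ (fun _ => true)).IsResponseCoeff N T D → D ≤ B)
    (hX : ∀ ω₂ lam β γ : ℝ, 0 < ω₂ → 0 < lam → 0 < β → 0 < γ → ∀ T : ℝ, 0 < T → ∀ B : ℝ, ∃ ℓ₁ : ℕ, ∀ ℓ : ℕ, ℓ₁ ≤ ℓ → ∃ N₀ : ℕ, ∀ N : ℕ, N₀ ≤ N → ∀ D' : ℝ, (Literature.MathematicalPhysics.KineticTheory.HeatConduction.cellChain ω₂ lam β γ (Literature.MathematicalPhysics.KineticTheory.HeatConduction.cellPeriodic ℓ)).IsResponseCoeff N T D' → B ≤ D') :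
    ∀ ω₂ lam β γ : ℝ, 0 < ω₂ → 0 < lam → 0 < β → 0 < γ → ∀ T : ℝ, 0 < T → ∃ ℓ₁ : ℕ, ∀ ℓ : ℕ, ℓ₁ ≤ ℓ → ∃ N₀ : ℕ, ∀ N : ℕ, N₀ ≤ N → ∀ D D' : ℝ, (Literature.MathematicalPhysics.KineticTheory.HeatConduction.cellChain ω₂ lam β γ (fun _ => true)).IsResponseCoeff N T D → (Literature.MathematicalPhysics.KineticTheory.HeatConduction.cellChain ω₂ lam β γ (Literature.MathematicalPhysics.KineticTheory.HeatConduction.cellPeriodic ℓ)).IsResponseCoeff N T D' → D ≤ D' := by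
  intro ω₂ lam β γ hω hl hβ hγ T hT
  obtain ⟨B, N₁, hN₁⟩ := hB ω₂ lam β γ hω hl hβ hγ T hT
  obtain ⟨ℓ₁, hℓ₁⟩ := hX ω₂ lam β γ hω hl hβ hγ T hT B
  refine ⟨ℓ₁, fun ℓ hℓ => ?_⟩
  obtain ⟨N₀, hN₀⟩ := hℓ₁ ℓ hℓ
  refine ⟨N₀ + N₁, fun N hN D D' hD hD' => ?_⟩
  exact (hN₁ N (by omega) D hD).trans (hN₀ N (by omega) D' hD')

end Proved

/-! ## The registered composition -/

/-- **The implication, sorry-free** (axioms `propext`, `Classical.choice`, `Quot.sound`):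
`stub_denseJunctionLaw`-statement → `stub_denseNonBallistic`-statement → `stub_diluteDelocalisation`-statement
→ the statement of `PhononLorentzGas.DilutionComparison` (its definiens VERBATIM; `DilutionComparison_of` below is
this term at the crux's name, applied to the three stubs). -/
theorem dilutionComparison_of_stubs :
    (∀ ω₂ lam β γ : ℝ, 0 < ω₂ → 0 < lam → 0 < β → 0 < γ → ∀ T : ℝ, 0 < T → ∀ ε : ℝ, 0 < ε → ε < 1 → ∃ r : ℝ, ∃ ℓ₁ : ℕ, ∀ ℓ : ℕ, ℓ₁ ≤ ℓ → ∃ N₀ : ℕ, ∀ N : ℕ, N₀ ≤ N → ∀ D d : ℝ, (Literature.MathematicalPhysics.KineticTheory.HeatConduction.cellChain ω₂ lam β γ (fun _ => true)).IsResponseCoeff N T D → (Literature.MathematicalPhysics.KineticTheory.HeatConduction.cellChain ω₂ lam β γ (fun _ => true)).IsResponseCoeff ℓ T d → 0 < D → 0 < d → ((N / ℓ : ℕ) : ℝ) * ((1 - ε) * (((ℓ : ℝ) - 1) / d) - r) ≤ ((N : ℝ) - 1) / D) →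
    (∀ ω₂ lam β γ : ℝ, 0 < ω₂ → 0 < lam → 0 < β → 0 < γ → ∀ T : ℝ, 0 < T → ∀ K : ℝ, 0 < K → ∀ ℓ₀ : ℕ, ∃ ℓ : ℕ, ℓ₀ ≤ ℓ ∧ ∀ d : ℝ, (Literature.MathematicalPhysics.KineticTheory.HeatConduction.cellChain ω₂ lam β γ (fun _ => true)).IsResponseCoeff ℓ T d → K * d ≤ (ℓ : ℝ) - 1) →
    (∀ ω₂ lam β γ : ℝ, 0 < ω₂ → 0 < lam → 0 < β → 0 < γ → ∀ T : ℝ, 0 < T → ∀ B : ℝ, ∃ ℓ₁ : ℕ, ∀ ℓ : ℕ, ℓ₁ ≤ ℓ → ∃ N₀ : ℕ, ∀ N : ℕ, N₀ ≤ N → ∀ D' : ℝ, (Literature.MathematicalPhysics.KineticTheory.HeatConduction.cellChain ω₂ lam β γ (Literature.MathematicalPhysics.KineticTheory.HeatConduction.cellPeriodic ℓ)).IsResponseCoeff N T D' → B ≤ D') →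
    (∀ ω₂ lam β γ : ℝ, 0 < ω₂ → 0 < lam → 0 < β → 0 < γ → ∀ T : ℝ, 0 < T → ∃ ℓ₁ : ℕ, ∀ ℓ : ℕ, ℓ₁ ≤ ℓ → ∃ N₀ : ℕ, ∀ N : ℕ, N₀ ≤ N → ∀ D D' : ℝ, (Literature.MathematicalPhysics.KineticTheory.HeatConduction.cellChain ω₂ lam β γ (fun _ => true)).IsResponseCoeff N T D → (Literature.MathematicalPhysics.KineticTheory.HeatConduction.cellChain ω₂ lam β γ (Literature.MathematicalPhysics.KineticTheory.HeatConduction.cellPeriodic ℓ)).IsResponseCoeff N T D' → D ≤ D') :=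
  fun hJ hNB hX =>
    dilutionComparison_of_denseUpper_of_delocalisation
      (denseEventualUpperBound_of_junction_of_nonBallistic hJ hNB) hX

/-- **Skeleton theorem — the crux `PhononLorentzGas.DilutionComparison` BY NAME from the three registered
stubs** (the ONLY theorem of this file concluding the crux; it takes no hypotheses; its `sorry`s are exactly
those of `stub_denseJunctionLaw`, `stub_denseNonBallistic`, `stub_diluteDelocalisation`; the seam is the
sorry-free `dilutionComparison_of_stubs`). -/
theorem DilutionComparison_of :
    _root_.Summit.AtomisticToContinuum.FouriersLaw.Theses.PhononLorentzGas.DilutionComparison :=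
  dilutionComparison_of_stubs stub_denseJunctionLaw stub_denseNonBallistic stub_diluteDelocalisation

end Birth

end Summit.AtomisticToContinuum.FouriersLaw.Cruxes.DilutionComparison

end
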